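/- Copyright: the b2b-balaban cell (near-miss cell 7), T⁴-continuum fan-out; row NE7b ROUND-2 swarm, seat
t4-ne7b-formalise-leaf-06 (gen 7) (road W-RP, sub-row «W-LAB», file 6: CANONICAL PATTERN TERMS — the terms of a
reader-labelled run ARE the reader's patterns; four clauses per cutoff; INTENT journal l.17482).  Released under the
licence of the surrounding project. -/
import Summits.QuantumFields.BalabanUV.T4Continuum.Support.HistoryChessboardLabelsGibbsReader

/-!
# Road W-RP, sub-row «W-LAB», file 6: CANONICAL PATTERN TERMS — a run displayed by ONE cube reader, four clauses per cutoff

Summits-side support leaf of the T⁴-continuum cell (rung (B)+1 on a FINITE torus only; NOT infinite volume, NOT the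
mass gap, NOT the Clay statement; NOT a proof of the spine estimate NE7b).  Row NE7b, road **W-RP** (R-OWNER-23-2 ∕
R-OWNER-23-8), sub-row «W-LAB», file 6, on top of file 5 (`HistoryChessboardLabelsGibbsReader`: `GibbsReaderEvents` —
eight clauses on a term label and a reader ⇒ W7's `GibbsCubeEvents`) and file 1's fibre lemma `measurableSet_labelFibre`.
[folklore] bookkeeping over TREE theorems; ONE DATA def (`badPatterns`, a `Finset` filter) and ONE hypothesis SHAPE
`structure GibbsReaderPattern … : Prop` (consumed only as a binder); no `[cite:]` tag, no `Prop`-valued FACT minted (c1),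
no constant (c2∕c6), no exit ∕ socket ∕ `HistoryConstants` file touched (c3); nothing of W7 ∕ 4t ∕ files 1–5 restated.

WHY.  In file 5 the term label `term` and the bad class `Bad` are still free data tied to the reader only by the pointwise
clause `bad_lab`.  The CANONICAL choice removes them: the term of a state IS its pattern of labels
(`term ω := fun c => f (towerTranslate K (cubeCorner h c) ω)`, `T := univ` over the finite pattern type
`BlockIdx 4 N → Λ`), and a term is bad iff its pattern shows a bad label somewhere (`Bad := badPatterns P`).  Then
`bad_subset`, `range`, `term_meas` (file 1's `measurableSet_labelFibre` — every fibre of the reader measurable) and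
`bad_lab` are THEOREMS, and what a cutoff displays is the READER ALONE.

WHAT.  `badPatterns P` (+ `mem_badPatterns`); **`structure GibbsReaderPattern D g₀ hm₁ K P f r`** — FOUR clauses:
`read_meas : ∀ l, MeasurableSet[towerBox G K (L^{m₁}) K] (f ⁻¹' {l})` (EVERY fibre of the reader is an event of the
reference cube column — all labels, since the pattern terms must be measurable), the pointwise `read_sym`, `univ_le`
((U1)×(G2)), `r_nonneg`; **`GibbsReaderPattern.readerEvents`** (file 5's eight), **`.gibbsCubeEvents`** (W7 v1.1's ten),
**`.side os`** (W7's eleven with the weights DEFINED by `weight`).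

HONEST SCOPE (R-OWNER-23-8 wording for road W-RP).  For a run read by canonical pattern terms the per-cutoff display of
road W is the READER: which function `f` of the reference cube column labels the field-size classes (that Bałaban's
large-field classes per cube ARE its fibres and that the terms of his 𝐑-operation expansion ARE the pattern events with
`Zrun ·` source-dressed masses as weights — (EXT) proper; in print the terms carry 𝐑-operations and analytic
continuations, not bare characteristic functions), its measurability and reflection symmetry, and `univ_le`
((B)'s content as a READING); per string NE7c's `shell` ∕ NE7's `budget` on the DEFINED pattern weights + the summable
rates stay displayed in W7's witness.  Nothing of H3 ∕ (B) ∕ BetaPertH discharged; 0∕9 unchanged.  NE7b NOT proved;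
spine 0∕9.  HONEST DEPENDENCY (cell): continuum YM on T⁴ ⇐ BetaPertH ∧ nine spine estimates (0/9 proved); BetaPertH ⇐
(D1) ∧ (D4) ∧ CAP+tail; G-an2-4 gates asym, D1 and NE2/3/4.  This file changes none of it.
-/

open Finset MeasureTheory Literature.Barriers.CriticalPhenomena.NonGibbs Literature.Probability.LatticeModels
open Literature.MathematicalPhysics.QuantumFieldTheory.Balaban1983to89
open Literature.MathematicalPhysics.QuantumFieldTheory.Balaban1983to89.Missing
open Literature.MathematicalPhysics.QuantumFieldTheory.Balaban1983to89.T4Continuum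
open Summit.QuantumFields.BalabanUV.T4Continuum HistoryChessboardEventsSplit HistoryChessboardEventsTower
open HistoryChessboardEventsCubes HistoryRPTowerLaw HistoryRPTowerCuts HistoryRPTowerTemplates HistoryRPTowerUniform
open HistoryChessboardEventsTemplates HistoryChessboardTowerRepr HistoryChessboardGibbsSide HistoryChessboardLabels
open HistoryChessboardLabelsReader HistoryChessboardLabelsGibbsReader

namespace Summit.QuantumFields.BalabanUV.T4Continuum.HistoryChessboardLabelsPattern

noncomputable section

/-! ## §1 Bad patterns -/

section Patterns

variable {Λ : Type*} [Fintype Λ] [DecidableEq Λ] {d N : ℕ} [NeZero N]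

/-- **THE BAD PATTERNS**: cube labellings of the block torus showing a bad label (one of `P`) at some cube. -/
def badPatterns (P : Finset Λ) : Finset (BlockIdx d N → Λ) := Finset.univ.filter fun p => ∃ c, p c ∈ P

/-- membership in `badPatterns`. [folklore] -/
@[simp] theorem mem_badPatterns {P : Finset Λ} {p : BlockIdx d N → Λ} : p ∈ badPatterns P ↔ ∃ c, p c ∈ P := by
  simp [badPatterns]

end Patterns

/-! ## §2 The reader pattern reading of a run on its own Gibbs cube tower -/

section Reader

variable {F : T4Family} {G : Type*} [GaugeGroup G] [MeasurableSpace G] [HaarData G] {Λ : Type*} [Fintype Λ]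
  [DecidableEq Λ]

/-- **THE READER PATTERN READING OF ONE RUN ON ITS OWN GIBBS CUBE TOWER** (HYPOTHESIS SHAPE — NOTHING asserted): ONE cube
reader `f` per cutoff; FOUR clauses.  The terms are the reader's PATTERNS (canonical), the bad class the patterns with
a bad label. [folklore] -/
structure GibbsReaderPattern (D : FiniteEpsData F G) (g₀ : ℕ → ℝ) {m₁ : ℕ} (hm₁ : m₁ ≤ F.m) (K : ℕ) (P : Finset Λ)
    (f : Tower (F.P K) G K → Λ) (r : ℝ) : Prop where
  /-- (LOC): every fibre of the reader is an event of the reference cube column -/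
  read_meas : ∀ l, MeasurableSet[towerBox G K (F.L ^ m₁) K] (f ⁻¹' {l})
  /-- (R-sym), pointwise: the reader on the reflected tower = the reader on the tower carried to the mirror cube -/
  read_sym : ∀ (i : Fin 4) (ω : Tower (F.P K) G K),
    f (towerRefl i K ω) = f (towerTranslate K (-axisVec (F.P K) K i (F.L ^ m₁)) ω)
  /-- (U1)+(G2), ratio currency: the pattern «every cube reads the bad label `l`» has probability `≤ r^(N^4)` -/
  univ_le : ∀ l ∈ P, (gibbsTower D g₀ K).real
    {ω | ∀ c : BlockIdx 4 (cubeCount F m₁), f (towerTranslate K (cubeCorner (sitesPerDir_top_eq F hm₁ K) c) ω) = l} ≤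
      r ^ (cubeCount F m₁ ^ 4)
  /-- the per-cell rate is nonnegative -/
  r_nonneg : 0 ≤ r

variable {D : FiniteEpsData F G} {g₀ : ℕ → ℝ} {m₁ : ℕ} {hm₁ : m₁ ≤ F.m} {K : ℕ} {P : Finset Λ}
  {f : Tower (F.P K) G K → Λ} {r : ℝ}

/-- **CANONICAL PATTERN TERMS GIVE FILE 5's EIGHT-CLAUSE READING**: `T := univ` (patterns), `Bad := badPatterns P`,
`term ω := (c ↦ f (towerTranslate K (cubeCorner h c) ω))`; `bad_subset`∕`range`∕`bad_lab` by the definitions, `term_meas`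
by file 1's `measurableSet_labelFibre` over W3o's `measurableSet_tEvent` (every fibre of the reader measurable).
[folklore] -/
theorem GibbsReaderPattern.readerEvents (H : GibbsReaderPattern D g₀ hm₁ K P f r) :
    GibbsReaderEvents D g₀ hm₁ K P (Finset.univ : Finset (BlockIdx 4 (cubeCount F m₁) → Λ)) (badPatterns P)
      (fun ω c => f (towerTranslate K (cubeCorner (sitesPerDir_top_eq F hm₁ K) c) ω)) f r where
  bad_subset := Finset.subset_univ _
  range := fun _ => Finset.mem_univ _
  term_meas := fun p _ =>
    measurableSet_labelFibre
      (lab := fun ω c => f (towerTranslate K (cubeCorner (sitesPerDir_top_eq F hm₁ K) c) ω))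
      (fun c l => measurableSet_tEvent (measurableSet_of_towerBox (H.read_meas l))
        (cubeCorner (sitesPerDir_top_eq F hm₁ K) c)) p
  bad_lab := fun _ hω => mem_badPatterns.1 hω
  read_meas := fun l _ => H.read_meas l
  read_sym := H.read_sym
  univ_le := H.univ_le
  r_nonneg := H.r_nonneg

/-- … hence W7 v1.1's TEN-clause `GibbsCubeEvents` with pattern terms. [folklore] -/
theorem GibbsReaderPattern.gibbsCubeEvents (H : GibbsReaderPattern D g₀ hm₁ K P f r) :
    GibbsCubeEvents D g₀ hm₁ K P (Finset.univ : Finset (BlockIdx 4 (cubeCount F m₁) → Λ)) (badPatterns P)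
      (fun p => (fun ω c => f (towerTranslate K (cubeCorner (sitesPerDir_top_eq F hm₁ K) c) ω)) ⁻¹' {p})
      (fun l c => {ω | f (towerTranslate K (cubeCorner (sitesPerDir_top_eq F hm₁ K) c) ω) = l}) r :=
  H.readerEvents.gibbsCubeEvents

/-- … and, for EVERY loop string, W7's eleven-clause `GibbsCubeSide` with the pattern weights DEFINED by `weight`.
[folklore] -/
theorem GibbsReaderPattern.side (H : GibbsReaderPattern D g₀ hm₁ K P f r) (os : List (ULoop F)) :
    GibbsCubeSide D g₀ os hm₁ K P (Finset.univ : Finset (BlockIdx 4 (cubeCount F m₁) → Λ))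
      (weight D g₀ os K fun p => (fun ω c => f (towerTranslate K (cubeCorner (sitesPerDir_top_eq F hm₁ K) c) ω)) ⁻¹' {p})
      (badPatterns P)
      (fun p => (fun ω c => f (towerTranslate K (cubeCorner (sitesPerDir_top_eq F hm₁ K) c) ω)) ⁻¹' {p})
      (fun l c => {ω | f (towerTranslate K (cubeCorner (sitesPerDir_top_eq F hm₁ K) c) ω) = l}) r :=
  H.readerEvents.side os

end Reader

end

end Summit.QuantumFields.BalabanUV.T4Continuum.HistoryChessboardLabelsPattern
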